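import Mathlib
import HarnessLib
import Summits.HubbardSuperconductivity.HubbardSuperconductivity.Theorems.KLProgrammeKLRegimeEngineV8PairTransferExport2
import Summits.HubbardSuperconductivity.HubbardSuperconductivity.Theorems.KLProgrammeKLRegimeEngineV8ExportUnroll2

/-!
# Route `KLProgramme` — ENGINE child gen 8 (stmt-HubbardSuperconductivity-20437 `KLRegimeEngineV17F2`), skeleton-v2 export class #5 «(S)-transfer»: the
# v2-COMPOSABLE STEP PROP `PairTransferStep3` over p1's rev-2 PINNED FAMILY (universal-raise history, v2 doors, class-#1 MERGED exports), its deferred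
# package `klTransferPkg3 / klCT3 / klCTu3`, and the UNROLL `pairTransferPinnedFamily_all_of_step3` (cell gate-hubbard-kl, seat p1b g12 = 20437 registrant;
# class-#5 PLUMBING owner per pen (R59ak); the MODEL layer — `klTransferWeight`, `IsSoftSymbol`, `PairTransferPinnedAt/Family`, its bridges — is p1 g11's p576787, untouched)

WHY A THIRD STEP PROP.  p1 g11's `PairTransferStep2 P R Q₀ r u` (p576787, (R54) rev 2) keeps rev 1's binder list VERBATIM: history at the `CR`-raised key
`HistP … G P (Q₀.withCR rr) …`, doors `klEngU₀9`, `klEngL₃`, class-#1 input `LevelsUExportAt L M (klCU P R Q₀) …` (the rev-1 export at the rev-1 table), threshold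
`u : ℝ → ℝ → ℝ` keyed on `rr`.  The v2 COMPOSITION of 20437 (render of record r7TB3E; sheet (R55)/(R57)) runs at the engine's own package `Q := klEngQ9c P R` (token #13) —
a raise of `klEngQ7 P R` in `CR` AND `CE` (`isRaiseOf_klEngQ9c`), NOT of the form `Q₀.withCR rr` — and holds the class-#1 exports only in the MERGED rev-2 form
`LevelsUExportMixedAt L M (klCU2 P R (klEngQ7 P R)) …` (unrolled from (X).1 `LevelsUStep2`).  A history `HistP … Q₀.withCR rr` is NOT derivable from `HistP … (klEngQ9c P R)`
(its `CE`-keyed slots are STRONGER at the smaller `CE`), and `klCU ≠ klCU2`; so §C cannot feed `PairTransferStep2` and stub (c)'s binder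
`htr : ∀ j ≤ n, <class-#5 family> … j` would be underivable from (X).3.  This file is the class-#5 twin of `LevelsUStep2` / `IsoTupleLineStepW` (the v2 successor
shape every other class uses): SAME family predicate `PairTransferPinnedFamily` (p1's), v2 binder list VERBATIM from `LevelsUStep2` (universal raise `Q₀.IsRaiseOf Q`,
`klEngC₃6`, `klEngU₀10`, `klEngL₄`, `klEngM₃`, history at `Q`, merged exports at `klCU2 P R Q₀` at every `j ≤ n`), threshold `u : EngConsts → ℝ → ℝ` read at the raise.
It is the §P2/§U placeholder text of the v2 render (J-drilled as the (X)/(c) shapes since r6) with the placeholder family replaced by p1's landed one.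

* §1 `IsTransferPkg3`, **`PairTransferStep3 P R Q₀ r u`**, `klTransferPkg3 / klCT3 / klCTu3` (`klCT3_nonneg`, `klCTu3_pos`), `pairTransferStep3_klCT3_of_exists/_of`;
* §2 **`pairTransferPinnedFamily_all_of_step3`** — the unroll (`exports_all_of_step₂`), the term §C's `htr` line calls.
Render tokens (v2 (X).3 / (c) / §C): `IsTransferPkgP_PH ↦ IsTransferPkg3`, `PairTransferStepP_PH ↦ PairTransferStep3`, `PairTransferFamilyCovP_PH ↦ PairTransferPinnedFamily`,
`klCTP_PH ↦ klCT3`, `klCTuP_PH ↦ klCTu3`, `pairTransferStepP_PH_of_exists ↦ pairTransferStep3_klCT3_of_exists`, `pairTransferFamilyCovP_all_of_stepP_PH ↦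
pairTransferPinnedFamily_all_of_step3`; DefsU11's class-#5 row reads `klCTu3 P R (klEngQ7 P R) (klEngQ9c P R) cc`.
Definitions with bodies + bookkeeping; nothing about the model is asserted; nothing asserts any stub of 20437, K3 or superconductivity.
-/

noncomputable section

namespace Summit.HubbardSuperconductivity.HubbardSuperconductivity.Theorems.EngineV8

set_option linter.dupNamespace false -- summit = problem name (single-conjunct summit), D-0017

open Real Finset Literature.MathematicalPhysics.QuantumLattice Literature.Probability.LatticeModels
open Literature.MathematicalPhysics.QuantumLattice.FermiRG
open Summit.HubbardSuperconductivity.HubbardSuperconductivity.Theorems.KLProgrammeLegKernels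
open Summit.HubbardSuperconductivity.HubbardSuperconductivity.Theorems.DispersionFlow
open Summit.HubbardSuperconductivity.HubbardSuperconductivity.Theorems.KLRegimeSplit

/-! ## §1 The v2-composable step, the admissible packages, the deferred package -/

/-- **An admissible class-#5 package, v2 shape**: a nonnegative transfer constant and a coupling threshold POSITIVE at every raised package (the class-#5
twin of `IsExportPkg2`'s threshold clause; rev 1's `IsTransferPkg` keys the threshold on a real `rr` instead). -/
def IsTransferPkg3 (e : ℝ × (EngConsts → ℝ → ℝ)) : Prop := 0 ≤ e.1 ∧ ∀ Q cc, 0 < e.2 Q cc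

/-- **`PairTransferStep3 P R Q₀ r u`** — class #5's induction step in the v2-COMPOSABLE shape (binder list of `LevelsUStep2` VERBATIM): for every geometry package `G`
(`G.WF`), every RAISE `Q` of the key package `Q₀` (`Q₀.IsRaiseOf Q` — the engine runs at `klEngQ9c P R`, a raise of `klEngQ7 P R`), under the v2 stub binders
(`0 < cc ≤ klEngC₃6 P R`, `μ ∈ klWindowC`, `0 < U ≤ klEngU₀10 P R cc`, the step's own threshold `U ≤ u Q cc`, `klBetaMin ≤ β ≤ e^{cc/U²}`, `klEngL₄ P R β U ≤ L`,
`klEngM₃ β U L ≤ M`, `n ≤ nScales β + 1`, `IsKLRegime`): the public history AT `Q`, the admissibility of `K_n`, the class-#1 MERGED exports `LevelsUExportMixedAt L M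
(klCU2 P R Q₀) …` at every `j ≤ n` and the pinned transfer families at every `j < n` give p1's `PairTransferPinnedFamily L M G P r β U μ n`. -/
def PairTransferStep3 (P : SplitConsts) (R : RenConsts) (Q₀ : EngConsts) (r : ℝ) (u : EngConsts → ℝ → ℝ) : Prop :=
  ∀ G : GeoConsts, G.WF → ∀ Q : EngConsts, Q₀.IsRaiseOf Q →
    ∀ cc : ℝ, 0 < cc → cc ≤ klEngC₃6 P R →
      ∀ μ ∈ klWindowC, ∀ U : ℝ, 0 < U → U ≤ klEngU₀10 P R cc → U ≤ u Q cc →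
        ∀ β : ℝ, klBetaMin ≤ β → β ≤ Real.exp (cc / U ^ 2) →
          ∀ (L M : ℕ) [NeZero L] [NeZero M], klEngL₄ P R β U ≤ L → klEngM₃ β U L ≤ M →
            ∀ n : ℕ, n ≤ nScales β + 1 → IsKLRegime U cc (-(n : ℤ)) →
              HistP klPredsV17F2 L M G P Q R β U μ 0 n →
                FrameOK R U (nScales β) μ (klFlowFrameU L M β U μ n) →
                  (∀ j ≤ n, LevelsUExportMixedAt L M (klCU2 P R Q₀) P β U μ j) →
                    (∀ j < n, PairTransferPinnedFamily L M G P r β U μ j) →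
                      PairTransferPinnedFamily L M G P r β U μ n

/-- The trivial package `(0, 1)` is admissible. -/
theorem isTransferPkg3_zero : IsTransferPkg3 (0, fun _ _ => 1) := ⟨le_rfl, fun _ _ => one_pos⟩

section Deferred

variable (P : SplitConsts) (R : RenConsts) (Q₀ : EngConsts)

/-- **The deferred transfer package, v2 shape**: SOME admissible `(r, u)` for which `PairTransferStep3 P R Q₀ r u` holds, if one exists, else the trivial package. -/
def klTransferPkg3 : ℝ × (EngConsts → ℝ → ℝ) :=
  open scoped Classical in
  if h : ∃ e : ℝ × (EngConsts → ℝ → ℝ), IsTransferPkg3 e ∧ PairTransferStep3 P R Q₀ e.1 e.2 then Classical.choose h else (0, fun _ _ => 1)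

/-- **The deferred transfer constant `klCT3 P R Q₀`** — a closed term today, adequate the day the class-#5 producer proves `PairTransferStep3 P R Q₀ r u` for an
admissible package (`pairTransferStep3_klCT3_of_exists`). -/
def klCT3 : ℝ := (klTransferPkg3 P R Q₀).1

/-- **The deferred coupling threshold `klCTu3 P R Q₀ : EngConsts → ℝ → ℝ`** (DefsU11's class-#5 row reads it at `(klEngQ9c P R, cc)`). -/
def klCTu3 : EngConsts → ℝ → ℝ := (klTransferPkg3 P R Q₀).2

/-- The deferred package is admissible (unconditionally). -/
theorem isTransferPkg3_klTransferPkg3 : IsTransferPkg3 (klTransferPkg3 P R Q₀) := by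
  classical
  unfold klTransferPkg3
  split_ifs with h
  · exact (Classical.choose_spec h).1
  · exact isTransferPkg3_zero

/-- `0 ≤ klCT3 P R Q₀` (unconditionally). -/
theorem klCT3_nonneg : 0 ≤ klCT3 P R Q₀ := (isTransferPkg3_klTransferPkg3 P R Q₀).1

/-- `0 < klCTu3 P R Q₀ Q cc` (unconditionally) — so a `min` with it keeps the engine's U-door positive. -/
theorem klCTu3_pos (Q : EngConsts) (cc : ℝ) : 0 < klCTu3 P R Q₀ Q cc := (isTransferPkg3_klTransferPkg3 P R Q₀).2 Q cc

variable {P R Q₀}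

/-- **The step holds for the deferred package as soon as it holds for some admissible package** (how §C reads (X).3). -/
theorem pairTransferStep3_klCT3_of_exists (h : ∃ e : ℝ × (EngConsts → ℝ → ℝ), IsTransferPkg3 e ∧ PairTransferStep3 P R Q₀ e.1 e.2) :
    PairTransferStep3 P R Q₀ (klCT3 P R Q₀) (klCTu3 P R Q₀) := by
  classical
  have hpkg : klTransferPkg3 P R Q₀ = Classical.choose h := by
    unfold klTransferPkg3
    rw [dif_pos h]
  unfold klCT3 klCTu3
  rw [hpkg]
  exact (Classical.choose_spec h).2

/-- Packaging an explicit witness. -/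
theorem pairTransferStep3_klCT3_of {r : ℝ} {u : EngConsts → ℝ → ℝ} (hr : 0 ≤ r) (hu : ∀ Q cc, 0 < u Q cc) (hs : PairTransferStep3 P R Q₀ r u) :
    PairTransferStep3 P R Q₀ (klCT3 P R Q₀) (klCTu3 P R Q₀) :=
  pairTransferStep3_klCT3_of_exists ⟨(r, u), ⟨hr, hu⟩, hs⟩

end Deferred

/-! ## §2 The unroll (the term §C's `htr` line calls) -/

section Unroll

variable {P : SplitConsts} {R : RenConsts} {Q₀ Q : EngConsts} {G : GeoConsts} {cc μ U β : ℝ} {L M : ℕ} [NeZero L] [NeZero M]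

/-- **CLASS #5 UNROLLED, v2 shape**: from `PairTransferStep3 P R Q₀ r u`, a geometry package `G` (`G.WF`), a raise `Q` of `Q₀`, the v2 binders, the bare frame's
admissibility `h0`, `R.WF2`, the public history up to `n ≤ n_β + 1` AT `Q` and the class-#1 merged exports at every `j ≤ n`: the pinned family at EVERY `j ≤ n`. -/
theorem pairTransferPinnedFamily_all_of_step3 {r : ℝ} {u : EngConsts → ℝ → ℝ} (hstep : PairTransferStep3 P R Q₀ r u) (hG : G.WF) (hQ : Q₀.IsRaiseOf Q)
    (hcc0 : 0 < cc) (hcc : cc ≤ klEngC₃6 P R) (hμ : μ ∈ klWindowC) (h0 : FrameOK R U (nScales β) μ 0) (hU : 0 < U) (hU10 : U ≤ klEngU₀10 P R cc)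
    (hUu : U ≤ u Q cc) (hβ : klBetaMin ≤ β) (hβc : β ≤ Real.exp (cc / U ^ 2)) (hL : klEngL₄ P R β U ≤ L) (hM : klEngM₃ β U L ≤ M) (hR : R.WF2)
    {n : ℕ} (hn : n ≤ nScales β + 1) (hhist : HistP klPredsV17F2 L M G P Q R β U μ 0 n)
    (hlev : ∀ j ≤ n, LevelsUExportMixedAt L M (klCU2 P R Q₀) P β U μ j) : ∀ j ≤ n, PairTransferPinnedFamily L M G P r β U μ j :=
  exports_all_of_step₂ (E := fun j => LevelsUExportMixedAt L M (klCU2 P R Q₀) P β U μ j) (F := fun j => PairTransferPinnedFamily L M G P r β U μ j) (N := n)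
    hlev
    (fun m hm hE hist => by
      have hmn : m ≤ nScales β + 1 := hm.trans hn
      have hhm : HistP klPredsV17F2 L M G P Q R β U μ 0 m := histP_klPredsV17F2_of_le hhist hm
      exact hstep G hG Q hQ cc hcc0 hcc μ hμ U hU hU10 hUu β hβ hβc L M hL hM m hmn (isKLRegime_of_le_nScales_succ hcc0.le hβ hβc hmn) hhm
        (frameOK_klFlowFrameU_of_histP hR h0 hmn hhm) hE hist)
    n le_rfl

end Unroll

end Summit.HubbardSuperconductivity.HubbardSuperconductivity.Theorems.EngineV8

end
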